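import Summits.CriticalPhenomena.SAWScalingLimit.Theorems.SAWLoopFugacityFlowSimpleSubseqLimitsTransferLocal
import HarnessLib

/-!
# Sketch (crux-strategist s2, Stein copy) — idea `stein-defect-from-the-tip` for crux stmt-CriticalPhenomena-4982

First-lemma typing for the crux idea: inside route SAWSteinDefect the child `SequentialSlitAvoidance`
(conditional far-slit avoidance given a first-entrance prefix) is the route's own defect calculus run FROM THE
PREFIX TIP. The value function's initial value at the tip is a RANDOM-WALK quantity — the lattice
excursion-avoidance ratio of the far hull seen from the tip of the slit graph — and the first checkable lemma
of the line is that it tends to `1` as the hull shrinks, uniformly along converging prefixes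
(`SlitExcursionFarAvoidance`, the from-the-tip twin of the route's `ExcursionInitialValue`, stmt-7519).
The arithmetic closing `1 - P(avoid) ≤ η + |balance| + |remainder|` is proved below. Not for landing.
-/

noncomputable section

open MeasureTheory Filter Topology Set Metric Function
open Literature.Probability.RandomPlanarGeometry Literature.Probability.RandomPlanarGeometry.SAW
open Literature.Probability.LatticeModels
open scoped ENNReal NNReal unitInterval

namespace Summit.CriticalPhenomena.SAWScalingLimit.Cruxes.SimpleSubseqLimits.SteinTip

open Summit.CriticalPhenomena.SAWScalingLimit.Theorems.SimpleSubseqLimits.SlitRestriction.Transfer (farPast)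
open Summit.CriticalPhenomena.SAWScalingLimit.Theorems.SimpleSubseqLimits.SlitRestriction.Arc (IsAdmissiblePast)

/-- Lattice excursion mass from the tip `w` to `v` avoiding the vertex list `S` after time `0` and stopped at
`v` (the route file's `H`, SAWSteinDefect: `4^{-|ω|}`-mass of nearest-neighbour walks of `Ω_δ`). -/
def excMass (Ω : Set ℂ) (δ : ℝ) (S : List (Site 2)) (w v : Site 2) : ℝ :=
  ∑' ω : (discreteDomainGraph Ω δ).Walk w v,
    if (∀ x ∈ ω.support.tail, x ∉ S) ∧ v ∉ ω.support.dropLast then (1 / 4 : ℝ) ^ ω.length else 0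

/-- The same mass restricted to excursions whose polyline stays `ε`-away from the closed set `F`
(the route file's `H'` with the hull subdomain `cl D'` replaced by the complement of the open
`ε`-thickening of `F`). -/
def excMassAvoid (Ω : Set ℂ) (δ : ℝ) (S : List (Site 2)) (w v : Site 2) (F : Set ℂ) (ε : ℝ) : ℝ :=
  ∑' ω : (discreteDomainGraph Ω δ).Walk w v,
    if (∀ x ∈ ω.support.tail, x ∉ S) ∧ v ∉ ω.support.dropLast ∧
        Set.range (ω.toCurve (meshPoint δ)) ∩ thickening ε F = ∅ then (1 / 4 : ℝ) ^ ω.length else 0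

/-- **FIRST LEMMA of the idea (random walk only; provable in principle by discrete potential theory):
SLIT EXCURSION FAR AVOIDANCE.** For every admissible limit past `π` at the entrance ball `B̄(q, ρ)`, guard
`R > ρ` and `η > 0` there is a width `ε > 0` such that along every sequence of meshes `s n → 0⁺` and lattice
first-entrance prefixes `ω n : a_{s n} → t n` converging to `π` (exactly the data of
`Transfer.SequentialSlitAvoidance`), eventually the lattice excursion from the tip `t n` to `b (s n)` in
`Ω_{s n}` that avoids the prefix stays `ε`-away from the closure of the far past `far_R(π)` with conditional
probability `≥ 1 - η` (cross-multiplied, junk-safe). The from-the-tip twin of `ExcursionInitialValue`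
(stmt-CriticalPhenomena-7519): restriction exponent `1` for the excursion, at a hull that shrinks onto a far
boundary arc of the slit domain. -/
def SlitExcursionFarAvoidance : Prop :=
  ∀ (D : DobrushinDomain) (a b : ℝ → Site 2), SAW.IsEndpointApprox D a b →
    ∀ (π : Curve ℂ) (q : ℂ) (ρ R : ℝ), 0 < ρ → ρ < R → IsAdmissiblePast D π q ρ →
      ∀ η : ℝ, 0 < η → ∃ ε : ℝ, 0 < ε ∧
        ∀ (s : ℕ → ℝ) (t : ℕ → Site 2) (ω : ∀ n : ℕ, SAW.DomainSAW D.carrier (s n) (a (s n)) (t n)),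
          Tendsto s atTop (𝓝[>] (0 : ℝ)) →
          (∀ n : ℕ, meshPoint (s n) (t n) ∈ closedBall q ρ) →
          (∀ n : ℕ, ∀ x ∈ (ω n).walk.support.dropLast, meshPoint (s n) x ∉ closedBall q ρ) →
          Tendsto (fun n => (ω n).curve) atTop (𝓝 (CurveClass.mk π)) →
          ∀ᶠ n in atTop,
            (1 - η) * excMass D.carrier (s n) (ω n).walk.support (t n) (b (s n)) ≤
              excMassAvoid D.carrier (s n) (ω n).walk.support (t n) (b (s n))
                (closure (farPast π q R)) ε

/-- **Arithmetic closing of the idea.** If the conditional avoidance probability decomposes à la Stein as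
`P = u + β + r` with initial value `u ≥ 1 - η` (`u = q₀^{5/8} ≥ q₀ ≥ 1 - η` for `q₀ ∈ [1 - η, 1]`) and
defect sums `|β| + |r| ≤ η`, then the conditional approach probability `1 - P` is at most `2η`. [folklore] -/
theorem approach_le_of_defect {P u β r η : ℝ} (hP : P = u + β + r) (hu : 1 - η ≤ u)
    (hd : |β| + |r| ≤ η) : 1 - P ≤ 2 * η := by
  have hβ := neg_abs_le β
  have hr := neg_abs_le r
  rw [hP]; linarith

/-- `q ^ (5/8) ≥ q` on `[0, 1]`: the SLE value function dominates the excursion value (so an excursion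
initial value `≥ 1 - η` gives an SLE initial value `≥ 1 - η`). [folklore] -/
theorem self_le_rpow_five_eighths {q : ℝ} (h0 : 0 ≤ q) (h1 : q ≤ 1) : q ≤ q ^ ((5 : ℝ) / 8) := by
  rcases h0.eq_or_lt with rfl | hq
  · simp
  · calc q = q ^ (1 : ℝ) := (Real.rpow_one q).symm
      _ ≤ q ^ ((5 : ℝ) / 8) := Real.rpow_le_rpow_of_exponent_ge hq h1 (by norm_num)

end Summit.CriticalPhenomena.SAWScalingLimit.Cruxes.SimpleSubseqLimits.SteinTip

end
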